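import Summits.QuantumFields.YangMills.Theorems.LangevinControlUVOSLegsFromFemtoAndGapStubAssemblyPermutations
import Summits.QuantumFields.YangMills.Theorems.MirrorModularBoostsHypercubicLimitPlaneLimitsDefs
import Summits.QuantumFields.YangMills.Theorems.MirrorModularBoostsHypercubicLimitClosureHalvesDefs
import Summits.QuantumFields.YangMills.Theorems.LangevinControlUVOSLegsAtWeakCouplingCDefs
import HarnessLib

/-!
# Crux `WeakCouplingHypercubicLimit` (stmt-QuantumFields-16120), line `Sketch`, r10 toolkit: exact invariance of the
summed plane-string limits under permutations of the coordinate axes (sub-goal SG-F `planeSum_linActMulti_coordPerm`)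

Helper file of the lead (c4) for the r10 skeleton `Cruxes/WeakCouplingHypercubicLimit/Lines/Sketch.lean`.  The
signed-permutation half of the hypercubic clause of the continuum limit needs the invariance of the candidate one-field
family `planeSum T = Σ_q T n q` of a `PlaneLimits r sch φ T` package
(`MirrorModularBoostsHypercubicLimitPlaneLimitsDefs`) under the coordinate permutations
`P_π : (P_π v)ᵢ = v_{π⁻¹ i}` of `ℝ⁴` (`coordPerm π`, toolkit XXIII
`LangevinControlUVOSLegsFromFemtoAndGapStubAssemblyPermutations`).  Coordinate permutations are EXACT lattice
symmetries, step by step: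

* `torusMomentStr_plaquette_coordPerm` — the centred torus moment of a string of plaquette observables with arbitrary
  additive normalisations is invariant under `corner ↦ π·corner`, `orientation ↦ re-sorted (π i, π j)` (the torus Wilson
  state is `configPerm π`-invariant, tree `wilsonMeasure_map_configPerm` packaged as `rpBlock_momentPerm`; a permuted
  plaquette is the re-sorted plaquette `permPlane π` at the permuted corner, `torusPlaquette_permPlane`);
* `planeDist_linActMulti_coordPerm` — hence `planeDist r sch k n q (P_π F) = planeDist r sch k n (permPlane π⁻¹ ∘ q) F`
  (`linActMulti_apply` + `coordPerm_symm_smul_siteToE` move the permutation onto the sites, `sum_piFinset_box_permSites`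
  reindexes the permutation-invariant box; the common counterterm `m_k/6` and the scalar `(c_k a_k⁴)ⁿ` do not depend on
  the string);
* `sum_planeDist_linActMulti_coordPerm` — summing over all strings `q : Fin n → Plane` absorbs the bijection
  `q ↦ permPlane π⁻¹ ∘ q` of `Planeⁿ` (`permPlane_valid`, `permPlane_symm_permPlane`);
* `planeSum_linActMulti_coordPerm` (SG-F) — pass to the limit along `φ` on `⁰𝒮` (`PlaneLimits.tendsto_planeSum`, `⁰𝒮` is
  `linActMulti`-stable by `IsOffDiagonal.linActMulti`, limits are unique).

Refs: OsterwalderSchrader1973 §2 (Euclidean covariance on `⁰𝒮`); Wilson1974 (hypercubic symmetry of the lattice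
action); GlimmJaffe1987 §6.1.
-/

noncomputable section

open scoped SchwartzMap BigOperators ComplexConjugate
open MeasureTheory Filter Topology
open Literature.MathematicalPhysics.QuantumFieldTheory Literature.MathematicalPhysics.QuantumLattice
open Literature.MathematicalPhysics.AQFT
open Literature.Probability.LatticeModels (box Site)
open Summit.QuantumFields.YangMills.Cruxes.HypercubicLimit.CouplingResponse
open Summit.QuantumFields.YangMills.Cruxes.OSLegsFromFemtoAndGap.DlrCollarTransfer (plane conn Decay RPPos ConnCS)
open Summit.QuantumFields.YangMills.Cruxes.OSLegsAtWeakCouplingC.Sketch (Separated)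
open Summit.QuantumFields.YangMills.Theorems.OSLegsFromFemtoAndGap

namespace Summit.QuantumFields.YangMills.Theorems.WeakCouplingHypercubicLimit.TraceNormColdPressure

section LatticeFacts

variable {G : Type} [Group G] [TopologicalSpace G] [IsTopologicalGroup G] [CompactSpace G]
  [MeasurableSpace G] [BorelSpace G]

/-- **String weights of plaquette observables are invariant under coordinate permutations** (arbitrary additive
normalisations): the centred torus moment of the re-sorted permuted orientations `permPlane π (q i)` at the permuted
corners `π·x` equals that of `q` at `x` (`rpBlock_momentPerm`: the torus Wilson state is `configPerm π`-invariant;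
`torusPlaquette_permPlane`: re-sorting an orientation does not change the plaquette observable). [folklore] -/
theorem torusMomentStr_plaquette_coordPerm (r : LatticeRep G) (β : ℝ) (L : ℕ) (π : Equiv.Perm (Fin 4)) {n : ℕ}
    (q : Fin n → Fin 4 × Fin 4) (m : Fin n → ℝ) (x : Fin n → Site 4) :
    torusMomentStr r.ρ β L (fun i U => plaquetteObs r.ρ 0 (permPlane π (q i)).1 (permPlane π (q i)).2 U) m
        (permSites π x) =
      torusMomentStr r.ρ β L (fun i U => plaquetteObs r.ρ 0 (q i).1 (q i).2 U) m x := by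
  unfold torusMomentStr
  have h := Summit.QuantumFields.YangMills.Cruxes.HypercubicLimit.ConditionalMeanTelescoping.rpBlock_momentPerm
    G r β L n π q m x
  have hl : ∀ (i : Fin n) (U : GaugeConfig 4 (2 * L + 1) G),
      plaquetteObs r.ρ 0 (q i).1 (q i).2 (configShift (-(x i)) (torusLift (2 * L + 1) U)) =
        Summit.QuantumFields.YangMills.Theorems.HypercubicLimit.Negative.torusPlaquette r (2 * L + 1)
          (q i).1 (q i).2 (x i) U :=
    fun i U => plane_torusLift r _ (q i) (x i) U
  have hr : ∀ (i : Fin n) (U : GaugeConfig 4 (2 * L + 1) G),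
      plaquetteObs r.ρ 0 (permPlane π (q i)).1 (permPlane π (q i)).2
          (configShift (-(permSites π x i)) (torusLift (2 * L + 1) U)) =
        Summit.QuantumFields.YangMills.Theorems.HypercubicLimit.Negative.torusPlaquette r (2 * L + 1)
          (π (q i).1) (π (q i).2) (fun j => x i (π.symm j)) U := fun i U => by
    rw [← torusPlaquette_permPlane]
    exact plane_torusLift r _ (permPlane π (q i)) (permSites π x i) U
  simp_rw [hl, hr]
  exact h.symm

/-- Undoing a coordinate permutation of the multi-sites: `π⁻¹·(π·x) = x`. [folklore] -/
theorem permSites_symm_permSites (π : Equiv.Perm (Fin 4)) {n : ℕ} (x : Fin n → Site 4) :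
    permSites π.symm (permSites π x) = x := by
  funext l i
  simp [permSites]

/-- **Coordinate permutations act on the renormalised plane-string distributions by re-sorting the string, exactly**:
`planeDist r sch k n q (P_π F) = planeDist r sch k n (permPlane π⁻¹ ∘ q) F` (move `P_π⁻¹` onto the lattice sites,
reindex the permutation-invariant box, and use the invariance of the string weights; the scalar `(c_k a_k⁴)ⁿ` and
the common counterterm `m_k/6` do not depend on the string). [folklore] -/
theorem planeDist_linActMulti_coordPerm (r : LatticeRep G) (sch : SpeciesScheme (YMSpecies G)) (k n : ℕ)
    (π : Equiv.Perm (Fin 4)) (q : Fin n → Plane) (F : 𝓢((Fin n → EuclideanSpace ℝ (Fin 4)), ℂ)) :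
    planeDist r sch k n q (linActMulti (coordPerm π) F) =
      planeDist r sch k n (fun i => (⟨permPlane π.symm (q i).1, permPlane_valid π.symm (q i).2⟩ : Plane)) F := by
  simp only [planeDist, FunLike.coe_smul, Pi.smul_apply]
  congr 1
  rw [latticeDistStr_apply, latticeDistStr_apply]
  simp_rw [linActMulti_apply, coordPerm_symm_smul_siteToE]
  rw [← sum_piFinset_box_permSites π (sch.L k)]
  refine Finset.sum_congr rfl fun x _ => ?_
  have hx : (fun i => sch.a k • siteToE fun j => permSites π x i (π j)) = fun i => sch.a k • siteToE (x i) := by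
    funext i
    simp [permSites]
  have hW : torusMomentStr r.ρ (sch.β k) (sch.L k) (fun i => (planeSpecies r (q i)).F)
        (fun _ => sch.m r.curvature k / 6) (permSites π x) =
      torusMomentStr r.ρ (sch.β k) (sch.L k)
        (fun i => (planeSpecies r (⟨permPlane π.symm (q i).1, permPlane_valid π.symm (q i).2⟩ : Plane)).F)
        (fun _ => sch.m r.curvature k / 6) x := by
    simp only [planeSpecies_F]
    rw [← torusMomentStr_plaquette_coordPerm r (sch.β k) (sch.L k) π.symm (fun i => (q i).1)
      (fun _ => sch.m r.curvature k / 6) (permSites π x), permSites_symm_permSites]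
  rw [hx, hW]

/-- **Exact invariance of the summed plane-string lattice distributions under coordinate permutations**: summing
`planeDist_linActMulti_coordPerm` over all strings `q : Fin n → Plane` absorbs the bijection `q ↦ permPlane π⁻¹ ∘ q`
of `Planeⁿ` (inverse `q ↦ permPlane π ∘ q`, `permPlane_symm_permPlane`). [folklore] -/
theorem sum_planeDist_linActMulti_coordPerm (r : LatticeRep G) (sch : SpeciesScheme (YMSpecies G)) (k n : ℕ)
    (π : Equiv.Perm (Fin 4)) (F : 𝓢((Fin n → EuclideanSpace ℝ (Fin 4)), ℂ)) :
    ∑ q : Fin n → Plane, planeDist r sch k n q (linActMulti (coordPerm π) F) =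
      ∑ q : Fin n → Plane, planeDist r sch k n q F := by
  refine Fintype.sum_bijective
    (fun (q : Fin n → Plane) (i : Fin n) => (⟨permPlane π.symm (q i).1, permPlane_valid π.symm (q i).2⟩ : Plane))
    (Function.bijective_iff_has_inverse.2
      ⟨fun q i => (⟨permPlane π (q i).1, permPlane_valid π (q i).2⟩ : Plane),
        fun q => funext fun i => Subtype.ext (by simpa using permPlane_symm_permPlane π.symm (q i).2),
        fun q => funext fun i => Subtype.ext (permPlane_symm_permPlane π (q i).2)⟩)
    _ _ fun q => planeDist_linActMulti_coordPerm r sch k n π q F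

end LatticeFacts

/-- **Registered sub-goal `planeSum_linActMulti_coordPerm` (SG-F, line `Sketch`, r10 toolkit): the summed plane-string
limits are invariant under permutations of the coordinate axes on `⁰𝒮`.**  Along a `PlaneLimits r sch φ T` package both
`k ↦ Σ_q planeDist r sch (φ k) n q (P_π F)` and `k ↦ Σ_q planeDist r sch (φ k) n q F` converge (`PlaneLimits.tendsto_planeSum`,
`P_π F ∈ ⁰𝒮` by `IsOffDiagonal.linActMulti`), to `planeSum T n (P_π F)` and `planeSum T n F`; the two sequences coincide
term by term (`sum_planeDist_linActMulti_coordPerm`), so the limits coincide. [folklore] -/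
theorem planeSum_linActMulti_coordPerm :
    ∀ (G : Type) [Group G] [TopologicalSpace G] [IsTopologicalGroup G] [CompactSpace G]
      [MeasurableSpace G] [BorelSpace G] (r : LatticeRep G) (sch : SpeciesScheme (YMSpecies G))
      (φ : ℕ → ℕ) (T : (n : ℕ) → (Fin n → Plane) → (𝓢((Fin n → EuclideanSpace ℝ (Fin 4)), ℂ) →L[ℂ] ℂ)),
      PlaneLimits r sch φ T → ∀ (π : Equiv.Perm (Fin 4)) (n : ℕ) (F : 𝓢((Fin n → EuclideanSpace ℝ (Fin 4)), ℂ)),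
        IsOffDiagonal F → planeSum T n (linActMulti (coordPerm π) F) = planeSum T n F := by
  intro G _ _ _ _ _ _ r sch φ T h π n F hF
  refine tendsto_nhds_unique (h.tendsto_planeSum _ (hF.linActMulti _)) ?_
  simp_rw [sum_planeDist_linActMulti_coordPerm]
  exact h.tendsto_planeSum F hF

end Summit.QuantumFields.YangMills.Theorems.WeakCouplingHypercubicLimit.TraceNormColdPressure

end
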